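import Summits.Schanuel.Schanuel.Theorems.ZilberEacParamRamifiedChart
import Summits.Schanuel.Schanuel.Theorems.ZilberEacRamifiedWitness
import Mathlib.Analysis.Calculus.InverseFunctionTheorem.Analytic
import HarnessLib

/-!
# Polynomially parametrised base curves, LXXV: the RAMIFIED WITNESS over a polynomial curve —
# exact exponential points with every large `kd`-th-power label, and the exact splitting of `g₁`

HONEST FRAMING.  Cell `pub-schanuel` (Zilber's Exponential-Algebraic Closedness, case ladder;
host summit Schanuel), seat 2, gen 27.  The analogue over a polynomially parametrised base curve
`(x₀, x₁) = (g₀(t), g₁(t))` (`deg g₀ = d ≥ 1`) of file LVIII (graphs `x₁ = p(x₀)`).  Let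
`t = s^{-k}`, `y₀ = ψ(s)` be a cycle of branches of the fibre curve `Q(t, y₀) = 0` at infinity
through `θ = e^τ = ψ(0) ≠ 0`, and `m` the chart of file LXXIV
(`2πi·m(s)^{-kd} = g₀(s^{-k}) - log(ψ(s)/θ) - τ`, `m(0) = 0`, `m'(0) ≠ 0`).
**`exists_ramified_witness_param`**: inverting `m` (Mathlib's analytic inverse function theorem) at
`μ_j = 1/(m₀ + j)` gives parameters `t_j` with `g₀(t_j) = τ + 2πi(m₀ + j)^{kd} + log(ψ/θ)`, i.e.
EXACT exponential points `e^{g₀(t_j)} = ψ`, `Q(t_j, e^{g₀(t_j)}) = 0`, with ALL large `kd`-th powers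
as labels, `‖g₀(t_j)‖ → ∞`, `‖g₀(t_j)‖ ≤ ‖τ‖ + 1 + 7(m₀ + j)^{kd}`; the POLAR FORM
`g₀(t_j) = U₀(μ_j)μ_j^{-kd}` (`U₀` analytic, `U₀(0) ≠ 0`) that THEOREM T of file LIX wants; and the
EXACT SPLITTING `g₁(t_j) = Π(m₀ + j) + r(μ_j)` with `Π ∈ ℂ[X]` of degree `k·deg g₁` (the Laurent part
of `g₁` along the pole, file LVII) and `r` analytic at `0` — so `e^{x₁} = e^{Π(m₀+j)}·e^{r(μ_j)}` has
POLYNOMIAL phases in the label, and gen 23's growth / resonance / Kronecker trichotomy applies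
(file LXXVI).  Also exported, for the algebraic step (file LXXVII): on small `s ≠ 0`,
`U₀(m(s))·m(s)^{-kd} = g₀(s^{-k})` and `r(m(s)) = g₁(s^{-k}) - Π(1/m(s))`.
[folklore analysis]; nothing here is specific to Schanuel's conjecture (neither used nor implied);
Mantova–Masser's question (PLMS 2024 §1 p. 5) and EC(3,2) stay OPEN.
-/

noncomputable section

open Filter Topology Polynomial Complex

set_option linter.dupNamespace false

namespace Summit.Schanuel.Schanuel.Theorems

/-- **The ramified witness over a polynomial curve.**  See the module docstring.
[folklore] (new in this form) -/
theorem exists_ramified_witness_param (Q : ℂ[X][X]) (g₀ g₁ : ℂ[X]) (hd : 1 ≤ g₀.natDegree)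
    {ψ : ℂ → ℂ} {θ : ℂ} (hθ0 : θ ≠ 0) {τ : ℂ} (hτ : Complex.exp τ = θ) {k : ℕ} (hk : 1 ≤ k)
    (hbranch : ∀ᶠ s in 𝓝[≠] (0 : ℂ), (Q.map (Polynomial.evalRingHom (s ^ k)⁻¹)).eval (ψ s) = 0)
    {m : ℂ → ℂ} (hman : AnalyticAt ℂ m 0) (hm0 : m 0 = 0) (hm' : deriv m 0 ≠ 0)
    (hchart : ∀ᶠ s in 𝓝 (0 : ℂ), AnalyticAt ℂ ψ s ∧ ψ s ≠ 0 ∧ ψ s / θ ∈ Complex.slitPlane ∧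
        ‖Complex.log (ψ s / θ)‖ < 1 ∧
        (s ≠ 0 → m s ≠ 0 ∧
          (2 * Real.pi * I) * (m s ^ (k * g₀.natDegree))⁻¹ =
            g₀.eval (s ^ k)⁻¹ - Complex.log (ψ s / θ) - τ)) :
    ∃ (U₀ r : ℂ → ℂ) (Pl : ℂ[X]) (m₀ : ℕ) (μ t : ℕ → ℂ),
      AnalyticAt ℂ U₀ 0 ∧ U₀ 0 ≠ 0 ∧ AnalyticAt ℂ r 0 ∧
      Pl.natDegree = k * g₁.natDegree ∧
      (∀ᶠ s in 𝓝[≠] (0 : ℂ), U₀ (m s) * (m s)⁻¹ ^ (k * g₀.natDegree) = g₀.eval (s ^ k)⁻¹ ∧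
        r (m s) = g₁.eval (s ^ k)⁻¹ - Pl.eval (m s)⁻¹) ∧
      (∀ j, μ j ≠ 0) ∧ Tendsto μ atTop (𝓝 0) ∧
      (∀ j, g₀.eval (t j) = U₀ (μ j) * (μ j)⁻¹ ^ (k * g₀.natDegree)) ∧
      (∀ j, (Q.map (Polynomial.evalRingHom (t j))).eval (Complex.exp (g₀.eval (t j))) = 0) ∧
      Tendsto (fun j => ‖g₀.eval (t j)‖) atTop atTop ∧
      (∀ j, ‖g₀.eval (t j)‖ ≤ ‖τ‖ + 1 + 7 * (((m₀ + j) ^ (k * g₀.natDegree) : ℕ) : ℝ)) ∧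
      (∀ j, g₁.eval (t j) = Pl.eval ((m₀ + j : ℕ) : ℂ) + r (μ j)) := by
  classical
  set d := g₀.natDegree with hdd
  set K := k * d with hKdef
  have hk0 : k ≠ 0 := by omega
  have hK0 : K ≠ 0 := Nat.mul_ne_zero hk0 (by omega)
  have hg0 : g₀ ≠ 0 := by rintro rfl; rw [Polynomial.natDegree_zero] at hdd; omega
  -- the analytic inverse `Sinv` of the chart `m`
  have hstrict : HasStrictDerivAt m (deriv m 0) 0 := hman.hasStrictDerivAt
  have hSan₀ : AnalyticAt ℂ (hstrict.localInverse m _ _ hm') (m 0) := hman.analyticAt_localInverse hm'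
  have hleft : ∀ᶠ s in 𝓝 (0 : ℂ), hstrict.localInverse m _ _ hm' (m s) = s :=
    hstrict.eventually_left_inverse hm'
  have hright₀ : ∀ᶠ μ in 𝓝 (m 0), m (hstrict.localInverse m _ _ hm' μ) = μ :=
    hstrict.eventually_right_inverse hm'
  have hSder₀ : HasStrictDerivAt (hstrict.localInverse m _ _ hm') (deriv m 0)⁻¹ (m 0) :=
    hstrict.to_localInverse hm'
  set Sinv : ℂ → ℂ := hstrict.localInverse m _ _ hm' with hSinv
  rw [hm0] at hSan₀ hright₀ hSder₀
  have hSan : AnalyticAt ℂ Sinv 0 := hSan₀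
  have hS0 : Sinv 0 = 0 := by
    have h := hleft.self_of_nhds
    rwa [hm0] at h
  have hSder : deriv Sinv 0 = (deriv m 0)⁻¹ := hSder₀.hasDerivAt.deriv
  -- `Sinv μ = μ · V μ`, `V` analytic with `V 0 ≠ 0`; `Ut = V^{-k}`
  set V : ℂ → ℂ := dslope Sinv 0 with hV
  have hVan : AnalyticAt ℂ V 0 := by
    obtain ⟨q, hq⟩ := hSan
    exact ⟨_, hq.has_fpower_series_dslope_fslope⟩
  have hV0 : V 0 ≠ 0 := by
    rw [hV, dslope_same, hSder]
    exact inv_ne_zero hm'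
  have hSV : ∀ μ, Sinv μ = μ * V μ := fun μ => by
    have h := eq_add_mul_dslope Sinv μ
    rwa [hS0, zero_add] at h
  set Ut : ℂ → ℂ := fun μ => (V μ ^ k)⁻¹ with hUt
  have hUtan : AnalyticAt ℂ Ut 0 := (hVan.pow k).inv (pow_ne_zero _ hV0)
  have hUt0 : Ut 0 ≠ 0 := inv_ne_zero (pow_ne_zero _ hV0)
  have hSU : ∀ μ, V μ ≠ 0 → (Sinv μ ^ k)⁻¹ = Ut μ * μ⁻¹ ^ k := by
    intro μ hVμ
    rw [hSV μ, hUt, mul_pow, mul_inv, inv_pow, mul_comm]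
  -- the polar form of `g₀` and the Laurent split of `g₁` along `t = Ut(μ) μ^{-k}`
  obtain ⟨U₀, hU₀an, hU₀0, hpolar⟩ := exists_polarForm_eval g₀ hUtan hk
  rw [← hdd] at hU₀0 hpolar
  have hU₀ne : U₀ 0 ≠ 0 := by
    rw [hU₀0]
    exact mul_ne_zero (Polynomial.leadingCoeff_ne_zero.2 hg0) (pow_ne_zero _ hUt0)
  obtain ⟨Pl, r, hPldeg, hPlc, hran, hlaur⟩ := exists_laurentPart g₁ hUtan hk
  have hPl : Pl.natDegree = k * g₁.natDegree := by
    by_cases hp : g₁ = 0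
    · have h0 : Pl.natDegree ≤ 0 := by simpa [hp] using hPldeg
      rw [Nat.le_zero.1 h0, hp, Polynomial.natDegree_zero, mul_zero]
    · refine Polynomial.natDegree_eq_of_le_of_coeff_ne_zero hPldeg ?_
      rw [hPlc]
      exact mul_ne_zero (Polynomial.leadingCoeff_ne_zero.2 hp) (pow_ne_zero _ hUt0)
  -- facts on small `μ`
  have hScont : Tendsto Sinv (𝓝 0) (𝓝 0) := by
    have h := hSan.continuousAt.tendsto
    rwa [hS0] at h
  have hVne : ∀ᶠ μ in 𝓝 (0 : ℂ), V μ ≠ 0 := hVan.continuousAt.eventually_ne hV0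
  have hbranch' : ∀ᶠ s in 𝓝 (0 : ℂ), s ≠ 0 →
      (Q.map (Polynomial.evalRingHom (s ^ k)⁻¹)).eval (ψ s) = 0 :=
    eventually_nhdsWithin_iff.1 hbranch
  have hgood : ∀ᶠ μ in 𝓝 (0 : ℂ), μ ≠ 0 → Sinv μ ≠ 0 ∧ m (Sinv μ) = μ ∧
      (Sinv μ ^ k)⁻¹ = Ut μ * μ⁻¹ ^ k ∧
      (Q.map (Polynomial.evalRingHom (Sinv μ ^ k)⁻¹)).eval (ψ (Sinv μ)) = 0 ∧
      ψ (Sinv μ) ≠ 0 ∧ ‖Complex.log (ψ (Sinv μ) / θ)‖ < 1 ∧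
      (2 * Real.pi * I) * (μ ^ K)⁻¹ =
        g₀.eval (Sinv μ ^ k)⁻¹ - Complex.log (ψ (Sinv μ) / θ) - τ := by
    filter_upwards [hright₀, hVne, hScont.eventually hchart, hScont.eventually hbranch']
      with μ hr hVμ hc hb hμ
    have hSμ : Sinv μ ≠ 0 := by rw [hSV μ]; exact mul_ne_zero hμ hVμ
    obtain ⟨-, hψne, -, hlog, hc'⟩ := hc
    obtain ⟨-, hid⟩ := hc' hSμ
    rw [hr] at hid
    exact ⟨hSμ, hr, hSU μ hVμ, hb hSμ, hψne, hlog, hid⟩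
  obtain ⟨δ, hδ, hball⟩ := Metric.eventually_nhds_iff.1 hgood
  -- the labels: `μ_j = 1/(m₀ + j)` with `1/m₀ < δ`
  obtain ⟨m₀, hm₀⟩ := exists_nat_gt δ⁻¹
  have hm₀pos : 0 < m₀ := Nat.cast_pos.1 (lt_trans (inv_pos.2 hδ) hm₀)
  set μ : ℕ → ℂ := fun j => (((m₀ + j : ℕ) : ℂ))⁻¹ with hμ
  have hlabpos : ∀ j, (0 : ℝ) < ((m₀ + j : ℕ) : ℝ) := fun j => by
    exact_mod_cast Nat.add_pos_left hm₀pos j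
  have hμne : ∀ j, μ j ≠ 0 := fun j => by
    rw [hμ]
    exact inv_ne_zero (by exact_mod_cast (Nat.add_pos_left hm₀pos j).ne')
  have hμnorm : ∀ j, ‖μ j‖ < δ := by
    intro j
    rw [hμ]
    simp only [norm_inv]
    rw [show ‖((m₀ + j : ℕ) : ℂ)‖ = ((m₀ + j : ℕ) : ℝ) by
      rw [← Complex.ofReal_natCast, Complex.norm_real, Real.norm_eq_abs, abs_of_pos (hlabpos j)]]
    calc (((m₀ + j : ℕ) : ℝ))⁻¹ ≤ ((m₀ : ℕ) : ℝ)⁻¹ := by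
          refine inv_anti₀ (by exact_mod_cast hm₀pos) ?_
          exact_mod_cast Nat.le_add_right m₀ j
      _ < δ := by
          rw [inv_lt_comm₀ (by exact_mod_cast hm₀pos) hδ]
          exact hm₀
  have hlab : Tendsto (fun j : ℕ => m₀ + j) atTop atTop :=
    tendsto_atTop_mono (fun j => Nat.le_add_left j m₀) tendsto_id
  have hμlim : Tendsto μ atTop (𝓝 0) :=
    (tendsto_inv_atTop_nhds_zero_nat (𝕜 := ℂ)).comp hlab
  have hfacts : ∀ j, Sinv (μ j) ≠ 0 ∧ m (Sinv (μ j)) = μ j ∧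
      (Sinv (μ j) ^ k)⁻¹ = Ut (μ j) * (μ j)⁻¹ ^ k ∧
      (Q.map (Polynomial.evalRingHom (Sinv (μ j) ^ k)⁻¹)).eval (ψ (Sinv (μ j))) = 0 ∧
      ψ (Sinv (μ j)) ≠ 0 ∧ ‖Complex.log (ψ (Sinv (μ j)) / θ)‖ < 1 ∧
      (2 * Real.pi * I) * (μ j ^ K)⁻¹ =
        g₀.eval (Sinv (μ j) ^ k)⁻¹ - Complex.log (ψ (Sinv (μ j)) / θ) - τ := fun j =>
    hball (by rw [dist_zero_right]; exact hμnorm j) (hμne j)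
  -- the parameters `t_j` and the points `x₀ = g₀(t_j)`
  set t : ℕ → ℂ := fun j => (Sinv (μ j) ^ k)⁻¹ with ht
  have hμinv : ∀ j, (μ j ^ K)⁻¹ = ((((m₀ + j) ^ K : ℕ)) : ℂ) := fun j => by
    rw [hμ]; push_cast; rw [inv_pow, inv_inv]
  have hzform : ∀ j, g₀.eval (t j) = τ + ((((m₀ + j) ^ K : ℕ)) : ℂ) * (2 * Real.pi * I) +
      Complex.log (ψ (Sinv (μ j)) / θ) := by
    intro j
    obtain ⟨-, -, -, -, -, -, hid⟩ := hfacts j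
    rw [ht]
    simp only
    rw [← hμinv j]
    linear_combination -hid
  have hexpz : ∀ j, Complex.exp (g₀.eval (t j)) = ψ (Sinv (μ j)) := by
    intro j
    obtain ⟨-, -, -, -, hψne, -, -⟩ := hfacts j
    rw [hzform j, Complex.exp_add, Complex.exp_add, hτ, Complex.exp_nat_mul_two_pi_mul_I, mul_one,
      Complex.exp_log (div_ne_zero hψne hθ0), mul_div_cancel₀ _ hθ0]
  have hnorm2π := norm_two_pi_I_lt_seven
  have hzup : ∀ j, ‖g₀.eval (t j)‖ ≤ ‖τ‖ + 1 + 7 * (((m₀ + j) ^ K : ℕ) : ℝ) := by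
    intro j
    obtain ⟨-, -, -, -, -, hlog, -⟩ := hfacts j
    rw [hzform j]
    have hK : (0 : ℝ) ≤ (((m₀ + j) ^ K : ℕ) : ℝ) := Nat.cast_nonneg _
    refine (norm_add_le _ _).trans ((add_le_add (norm_add_le _ _) hlog.le).trans ?_)
    rw [norm_mul, Complex.norm_natCast]
    nlinarith
  have hzlow : ∀ j, 6 * ((m₀ + j : ℕ) : ℝ) - (‖τ‖ + 1) ≤ ‖g₀.eval (t j)‖ := by
    intro j
    obtain ⟨-, -, -, -, -, hlog, -⟩ := hfacts j
    have hK : ((m₀ + j : ℕ) : ℝ) ≤ (((m₀ + j) ^ K : ℕ) : ℝ) := by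
      exact_mod_cast Nat.le_self_pow hK0 (m₀ + j)
    have h2π : (6 : ℝ) ≤ ‖(2 * Real.pi * I : ℂ)‖ := by
      rw [show (2 * Real.pi * I : ℂ) = ((2 * Real.pi : ℝ) : ℂ) * I by push_cast; ring, norm_mul,
        Complex.norm_I, mul_one, Complex.norm_real, Real.norm_eq_abs, abs_of_pos Real.two_pi_pos]
      have := Real.pi_gt_three
      linarith
    have hmain : ‖((((m₀ + j) ^ K : ℕ)) : ℂ) * (2 * Real.pi * I)‖ -
        ‖τ + Complex.log (ψ (Sinv (μ j)) / θ)‖ ≤ ‖g₀.eval (t j)‖ := by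
      rw [hzform j, show τ + ((((m₀ + j) ^ K : ℕ)) : ℂ) * (2 * Real.pi * I) +
        Complex.log (ψ (Sinv (μ j)) / θ) = ((((m₀ + j) ^ K : ℕ)) : ℂ) * (2 * Real.pi * I) +
        (τ + Complex.log (ψ (Sinv (μ j)) / θ)) by ring]
      exact norm_sub_le_norm_add _ _
    rw [norm_mul, Complex.norm_natCast] at hmain
    have h3 : ‖τ + Complex.log (ψ (Sinv (μ j)) / θ)‖ ≤ ‖τ‖ + 1 :=
      (norm_add_le _ _).trans (by linarith)
    have hK0' : (0 : ℝ) ≤ ((m₀ + j : ℕ) : ℝ) := Nat.cast_nonneg _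
    nlinarith
  have hznorm : Tendsto (fun j => ‖g₀.eval (t j)‖) atTop atTop := by
    refine Literature.ModelTheory.Zilber.tendsto_norm_atTop_of_le
      (K := fun j => ((m₀ + j : ℕ) : ℝ)) ?_ (a := 6) (b := ‖τ‖ + 1) (by norm_num) hzlow
    exact tendsto_natCast_atTop_atTop.comp hlab
  refine ⟨U₀, r, Pl, m₀, μ, t, hU₀an, hU₀ne, hran, hPl, ?_, hμne, hμlim, fun j => ?_, fun j => ?_,
    hznorm, hzup, fun j => ?_⟩
  · -- the identities along `μ = m(s)`
    have hmcont : Tendsto m (𝓝 0) (𝓝 0) := by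
      have h := hman.continuousAt.tendsto
      rwa [hm0] at h
    have hev : ∀ᶠ s in 𝓝 (0 : ℂ), s ≠ 0 → U₀ (m s) * (m s)⁻¹ ^ K = g₀.eval (s ^ k)⁻¹ ∧
        r (m s) = g₁.eval (s ^ k)⁻¹ - Pl.eval (m s)⁻¹ := by
      filter_upwards [hleft, hchart, hmcont.eventually hgood] with s hl hc hg hs
      obtain ⟨hms, -⟩ := hc.2.2.2.2 hs
      obtain ⟨-, -, hSU', -, -, -, -⟩ := hg hms
      rw [hl] at hSU'
      refine ⟨?_, ?_⟩
      · rw [hSU', hpolar (m s) hms]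
      · have h := hlaur (m s) hms
        rw [← hSU'] at h
        linear_combination -h
    exact eventually_nhdsWithin_iff.2 hev
  · obtain ⟨-, -, hSU', -, -, -, -⟩ := hfacts j
    rw [ht]
    simp only
    rw [hSU', hpolar (μ j) (hμne j)]
  · obtain ⟨-, -, -, hQ, -, -, -⟩ := hfacts j
    rw [hexpz j, ht]
    exact hQ
  · obtain ⟨-, -, hSU', -, -, -, -⟩ := hfacts j
    have h := hlaur (μ j) (hμne j)
    rw [ht]
    simp only
    rw [hSU', h, hμ, inv_inv]

end Summit.Schanuel.Schanuel.Theorems
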